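import Literature.AlgebraicGeometry.HodgeTheory.SupportedClassesHodgeConiveauProofs
import Literature.AlgebraicGeometry.HodgeTheory.ComplexConjugationHolds
import Literature.AlgebraicGeometry.HodgeTheory.SupportedClassesIrreducible
import Literature.AlgebraicGeometry.HodgeTheory.ComplexGysinHodgeType
import Literature.AlgebraicGeometry.HodgeTheory.HodgeTypeConjugation
import Literature.AlgebraicGeometry.HodgeTheory.GysinFormalismHodgeOfGysin
import Literature.AlgebraicGeometry.HodgeTheory.SupportedHodgeClassDescent
import Literature.AlgebraicGeometry.HodgeTheory.ThomGysinClosedImmersion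
import Literature.AlgebraicGeometry.HodgeTheory.GysinKernelProofs
import Literature.AlgebraicGeometry.Resolution.ProjectiveResolutionProofs
import Summits.HodgeConjecture.HodgeConjecture.Theses.NikulinTwinTransport

/-!
# Route NikulinTwinTransport · `AlgebraicClassesOneOneK3` (stmt-HodgeConjecture-15041) —
# algebraic divisor classes on a projective K3 surface are of Hodge type `(1,1)`: reductions

The item: for every projective K3 surface `S` (the route's unfolded `IsK3Surface S`) and every
`d ∈ algebraicClasses S 1 = N¹H²(S(ℂ); ℂ)`, `IsOfHodgeType 2 S (2*1) 1 1 d` (Voisin I, Prop. 11.20;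
Grothendieck 1969 p. 300, the `(n,k,s) = (2,2,1)` slice of
`Grothendieck1969_supportedClasses_le_hodgeConiveau`).

This file PROVES the statement for EVERY smooth projective surface (the K3 hypotheses are not
used) from exactly two inputs, everything else being theorems of the tree:

* (N1) de Rham's theorem in multiplicative form, the named fact
  `Literature.NumberTheory.Transcendental.exists_deRhamIsoFamily` (through
  `isOfHodgeType_complexGysin`: Gysin morphisms `g_* : H⁰(C(ℂ)) → H²(S(ℂ))` of morphisms from curves
  have bidegree `(1,1)`, Voisin I §7.3.2 with Lemma 7.30);
* (N2) the CURVE SLICE of Deligne's kernel theorem (Hodge III, Cor. 8.2.8 in degree `b = 2` on a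
  surface): for an irreducible Zariski-closed curve `V ⊆ S` there is a morphism `g : C ⟶ S` from a
  smooth projective curve with `ker (H²(S(ℂ)) → H²((S ∖ V)(ℂ))) ⊆ im (g_* : H⁰(C(ℂ)) → H²(S(ℂ)))`
  (hypothesis `hK` of `isOfHodgeType_oneOne_of_mem_algebraicClasses_of_curveKernel`). It follows from
  the named fact `Deligne1974_ker_restrictCompl_eq_iSup_range_complexGysin` with projective Hironaka
  (PROVED in the tree) — `curveKernel_of_deligne` — and holds UNCONDITIONALLY for smooth `V` (the
  tree's `ker_restrictCompl_eq_iSup_range_complexGysin_of_isClosedImmersion`); the singular irreducible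
  curves are the residual content, Deligne's Prop. 8.2.7 in Čech form for the normalisation.

Chain (Fulton 1998 §19.1 Lemma 19.1.1; Voisin I Prop. 11.20): `N¹H² = Σ_V ker (H² → H²(S ∖ V))`
over the irreducible closed `V` of codimension exactly `1` (`algebraicClasses_eq_iSup_coheight_genericPoint_eq`,
PROVED: additivity + semipurity); each kernel lies in a Gysin image `g_* H⁰(C(ℂ))` (N2); classes of
`H⁰` are of type `(0,0)` (`isOfHodgeType_zero_zero_zero`) and `g_*` has bidegree `(1,1)` (N1); the
classes of type `(1,1)` form a subspace (Hodge type read in one model,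
`isOfHodgeType_iff_mem_hodgePQ`, PROVED independence of the model).

Results: `exists_resolution_of_irreducible_curve` (a resolution `g : C ⟶ S` of an irreducible curve,
image exactly `V`; Hironaka, projective form, PROVED in the tree), `curveKernel_of_deligne`,
`isOfHodgeType_oneOne_of_mem_algebraicClasses_of_curveKernel` (all smooth projective surfaces),
`isOfHodgeType_oneOne_of_mem_algebraicClasses_of_deligne`, and the K3 statement of the item in both
conditional forms (`algebraicClassesOneOneK3_of_curveKernel`, `algebraicClassesOneOneK3_of_deligne`).
-/

noncomputable section

-- `Summit.HodgeConjecture.HodgeConjecture.Theorems` is the mandated namespace (single-problem summit: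
-- Problem = Summit), which `linter.dupNamespace` flags; the lakefile turns the linter off tree-wide
-- (weak option), restated here so stand-alone elaboration is warning-free too.
set_option linter.dupNamespace false

namespace Summit.HodgeConjecture.HodgeConjecture.Theorems.NikulinTwinTransport

open scoped Manifold
open CategoryTheory AlgebraicGeometry
open Literature.AlgebraicGeometry Literature.AlgebraicGeometry.Motives
open Literature.AlgebraicGeometry.HodgeTheory
open Literature.AlgebraicTopology.SingularHomology
open Literature.NumberTheory.Transcendental (exists_deRhamIsoFamily)

section Surface

variable {S : SchemeOver ℂ}

/-! ### A resolution of an irreducible curve on a smooth projective surface -/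

/-- **An irreducible curve on a smooth projective surface is the image of a smooth projective
curve**: for `S` smooth projective of dimension `2` and `V ⊆ S` Zariski-closed, irreducible, with
generic point of codimension `1`, there are a smooth projective curve `C` and a birational morphism
`π : C ⟶ V` onto `V` with its reduced structure (`Motives.ClosedSubvariety.ofPoint`), whose composite
`g = π ≫ ι_V : C ⟶ S` has image exactly `V` (projective Hironaka, Kollár 2007 Thm. 3.27 — the tree's
theorem `Resolution.Hironaka1964_projective_holds`; a proper birational morphism is surjective).
[cite: Kollar2007, Thm. 3.27] [cite: Hartshorne1977, II Ex. 3.20] -/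
theorem exists_resolution_of_irreducible_curve (hS : IsSmoothProjective 2 S) {V : Set S.left}
    (hV : IsClosed V) (hirr : IsIrreducible V) (hgen : Order.coheight hirr.genericPoint = 1) :
    ∃ (C : SchemeOver ℂ) (_ : IsSmoothProjective 1 C)
      (π : C ⟶ (ClosedSubvariety.ofPoint S.left hirr.genericPoint).toSchemeOver),
      Resolution.IsBirational π.left ∧
        Set.range (π ≫ (ClosedSubvariety.ofPoint S.left hirr.genericPoint).ιOver).left.base = V := by
  set x := hirr.genericPoint with hxdef
  have hx : closure {x} = V := hirr.closure_genericPoint hV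
  set X₀ := ClosedSubvariety.ofPoint S.left x with hX₀
  haveI : IsIntegral X₀.toSchemeOver.left := inferInstanceAs (IsIntegral X₀.carrier)
  obtain ⟨d, C, π, hC, hπ, hdim⟩ := Resolution.Hironaka1964_projective_holds ℂ X₀.toSchemeOver
    (isProjectiveOver_toSchemeOver X₀ hS.isProjectiveOver)
  -- `d = height x = 1`
  have h1 : Order.height x = (d : ℕ∞) := by
    have e1 : X₀.ι.base (genericPoint X₀.carrier) = x := ClosedSubvariety.genericPoint_ofPoint x
    have e2 : Order.height (X₀.ι.base (genericPoint X₀.carrier)) =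
        Order.height (genericPoint X₀.carrier) :=
      Motives.Scheme.height_base_eq_of_isClosedImmersion _ _
    rw [← e1, e2]
    exact hdim
  obtain ⟨a, c, ha, hc, hac⟩ := exists_height_eq_coheight_eq hS x
  rw [ha] at h1
  rw [hc] at hgen
  have h1' : a = d := by exact_mod_cast h1
  have h2' : c = 1 := by exact_mod_cast hgen
  obtain rfl : d = 1 := by omega
  refine ⟨C, hC, π, hπ, ?_⟩
  -- the image: `π` is surjective and `X₀.ι` has image `closure {x} = V`
  haveI : IsProper π.left := by
    haveI : IsProper C.hom := IsSmoothProjective.isProper_holds hC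
    haveI : IsProper X₀.toSchemeOver.hom :=
      IsProjectiveOver.isProper (isProjectiveOver_toSchemeOver X₀ hS.isProjectiveOver)
    have h : IsProper (π.left ≫ X₀.toSchemeOver.hom) := by
      rw [Over.w π]
      infer_instance
    exact MorphismProperty.of_postcomp (W := @IsProper) (W' := @IsSeparated) π.left
      X₀.toSchemeOver.hom inferInstance h
  have hsurj := surjective_base_of_isBirational π.left hπ
  refine Set.Subset.antisymm ?_ fun z hz ↦ ?_
  · rintro _ ⟨y, rfl⟩
    have hmem : X₀.ι.base (π.left.base y) ∈ closure {x} := by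
      rw [← ClosedSubvariety.range_ofPoint_ι x]
      exact ⟨_, rfl⟩
    rw [hx] at hmem
    exact hmem
  · rw [← hx, ← ClosedSubvariety.range_ofPoint_ι x] at hz
    obtain ⟨v, rfl⟩ := hz
    obtain ⟨y, rfl⟩ := hsurj v
    exact ⟨y, rfl⟩

/-! ### (N2) from Deligne's named fact -/

/-- **The curve slice of Deligne's Cor. 8.2.8, from the named fact.** For `S` smooth projective of
dimension `2`, `V ⊆ S` closed irreducible with generic point of codimension `1`, and any orientation
family `μ`: with `g : C ⟶ S` a resolution of `V` (`exists_resolution_of_irreducible_curve`),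
`ker (H²(S(ℂ)) → H²((S ∖ V)(ℂ))) ⊆ im (g_* : H⁰(C(ℂ)) → H²(S(ℂ)))` — Deligne's exactness of
`H⁰(C) → H²(S) → H²(S ∖ V)` for the single morphism `g` (the only source degree `a` with
`a + 4 = 2 + 2` is `a = 0`). [cite: DeligneHodgeIII1974, Cor. 8.2.8] [cite: Fulton1998, §19.1 Lemma 19.1.1] -/
theorem curveKernel_of_deligne (hD : Deligne1974_ker_restrictCompl_eq_iSup_range_complexGysin)
    (μ : OrientationFamily) ⦃S : SchemeOver ℂ⦄ (hS : IsSmoothProjective 2 S) (V : Set S.left)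
    (hV : IsClosed V) (hirr : IsIrreducible V) (hgen : Order.coheight hirr.genericPoint = 1) :
    ∃ (C : SchemeOver ℂ) (hC : IsSmoothProjective 1 C) (g : C ⟶ S),
      LinearMap.ker (complexBetti.restrictCompl S V (2 * 1)).hom ≤
        LinearMap.range (complexGysin μ hC hS g (rfl : 0 + 2 * 2 = 2 * 1 + 2 * 1)) := by
  obtain ⟨C, hC, π, -, hrange⟩ := exists_resolution_of_irreducible_curve hS hV hirr hgen
  refine ⟨C, hC, π ≫ (ClosedSubvariety.ofPoint S.left hirr.genericPoint).ιOver, ?_⟩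
  have h := Deligne1974_ker_restrictCompl_eq_iSup_range_complexGysin.ker_restrictCompl_range_eq hD μ
    μ.hasPoincareDuality hS hC (π ≫ (ClosedSubvariety.ofPoint S.left hirr.genericPoint).ιOver) (2 * 1)
  rw [hrange] at h
  rw [h]
  refine iSup_le fun a ↦ iSup_le fun hab ↦ ?_
  obtain rfl : a = 0 := by omega
  exact le_rfl

/-! ### Algebraic divisor classes on a smooth projective surface are of type `(1,1)` -/

/-- **Algebraic classes of codimension `1` on a smooth projective surface are of Hodge type `(1,1)`,
granted de Rham multiplicativity (N1) and the curve slice of Deligne's kernel theorem (N2).**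
Proof (Fulton 1998, §19.1 Lemma 19.1.1 with Voisin I, Prop. 11.20 / §7.3.2): `N¹H²(S(ℂ); ℂ)` is the
sum over the irreducible closed curves `V ⊆ S` of `ker (H² → H²(S ∖ V))`
(`algebraicClasses_eq_iSup_coheight_genericPoint_eq`); by `hK` such a kernel lies in
`g_* H⁰(C(ℂ))` for a morphism `g` from a smooth projective curve; classes of `H⁰` are of type
`(0,0)` (`isOfHodgeType_zero_zero_zero`) and `g_*` has bidegree `(1,1)` (`isOfHodgeType_complexGysin`,
fed with the tree's `hodgePQ_independent_of_hodgeModel_holds`, `nonempty_hodgeModel_holds` and `hdR`);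
the `(1,1)`-classes form a subspace (read in one Hodge model, `isOfHodgeType_iff_mem_hodgePQ`).
[cite: VoisinHodgeI2002, Prop. 11.20 and §7.3.2] [cite: Fulton1998, §19.1 Lemma 19.1.1] -/
theorem isOfHodgeType_oneOne_of_mem_algebraicClasses_of_curveKernel
    (hdR : ∀ (E : Type) [NormedAddCommGroup E] [NormedSpace ℂ E] [FiniteDimensional ℂ E],
      exists_deRhamIsoFamily 𝓘(ℝ, E))
    (μ : OrientationFamily)
    (hK : ∀ ⦃S : SchemeOver ℂ⦄ (hS : IsSmoothProjective 2 S) (V : Set S.left), IsClosed V →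
      ∀ hirr : IsIrreducible V, Order.coheight hirr.genericPoint = 1 →
        ∃ (C : SchemeOver ℂ) (hC : IsSmoothProjective 1 C) (g : C ⟶ S),
          LinearMap.ker (complexBetti.restrictCompl S V (2 * 1)).hom ≤
            LinearMap.range (complexGysin μ hC hS g (rfl : 0 + 2 * 2 = 2 * 1 + 2 * 1)))
    ⦃S : SchemeOver ℂ⦄ (hS : IsSmoothProjective 2 S) ⦃d : complexBetti S (2 * 1)⦄
    (hd : d ∈ algebraicClasses S 1) : IsOfHodgeType 2 S (2 * 1) 1 1 d := by
  obtain ⟨A⟩ := (nonempty_hodgeModel_holds (n := 2) (X := S)) hS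
  -- the `(1,1)`-classes, read in the model `A`
  let T : Submodule ℂ (complexBetti S (2 * 1)) := (A.hodgePQ (2 * 1) 1 1).comap (A.pullback (2 * 1)).hom
  suffices h : algebraicClasses S 1 ≤ T from
    (isOfHodgeType_iff_mem_hodgePQ hS A d).2 (h hd)
  rw [algebraicClasses_eq_iSup_coheight_genericPoint_eq hS 1]
  refine iSup_le fun V ↦ iSup_le fun hV ↦ iSup_le fun hirr ↦ iSup_le fun _ ↦ iSup_le fun hgen ↦ ?_
  have hgen' : Order.coheight hirr.genericPoint = 1 := by exact_mod_cast hgen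
  obtain ⟨C, hC, g, hle⟩ := hK hS V hV hirr hgen'
  refine hle.trans ?_
  rintro _ ⟨y, rfl⟩
  obtain ⟨B⟩ := (nonempty_hodgeModel_holds (n := 1) (X := C)) hC
  have hy : IsOfHodgeType 1 C 0 0 0 y := isOfHodgeType_zero_zero_zero B y
  have h11 : IsOfHodgeType 2 S (2 * 1) 1 1
      (complexGysin μ hC hS g (rfl : 0 + 2 * 2 = 2 * 1 + 2 * 1) y) :=
    isOfHodgeType_complexGysin hodgePQ_independent_of_hodgeModel_holds
      (fun m Y ↦ nonempty_hodgeModel_holds) hdR μ hC hS g rfl (p := 0) (q := 0) (p' := 1) (q' := 1)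
      (by omega) (by omega) hy
  exact (isOfHodgeType_iff_mem_hodgePQ hS A _).1 h11

/-- **The same from the two named facts**: Deligne's kernel theorem
(`Deligne1974_ker_restrictCompl_eq_iSup_range_complexGysin`) and de Rham multiplicativity
(`exists_deRhamIsoFamily`) imply that algebraic divisor classes on every smooth projective surface
are of type `(1,1)`. [cite: DeligneHodgeIII1974, Cor. 8.2.8] [cite: VoisinHodgeI2002, Prop. 11.20] -/
theorem isOfHodgeType_oneOne_of_mem_algebraicClasses_of_deligne
    (hD : Deligne1974_ker_restrictCompl_eq_iSup_range_complexGysin)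
    (hdR : ∀ (E : Type) [NormedAddCommGroup E] [NormedSpace ℂ E] [FiniteDimensional ℂ E],
      exists_deRhamIsoFamily 𝓘(ℝ, E))
    ⦃S : SchemeOver ℂ⦄ (hS : IsSmoothProjective 2 S) ⦃d : complexBetti S (2 * 1)⦄
    (hd : d ∈ algebraicClasses S 1) : IsOfHodgeType 2 S (2 * 1) 1 1 d :=
  let μ : OrientationFamily := fun _ _ hY ↦ (ComplexPoints.isOrientableOver ℂ hY).some
  isOfHodgeType_oneOne_of_mem_algebraicClasses_of_curveKernel hdR μ (curveKernel_of_deligne hD μ) hS hd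

end Surface

/-! ### The item's statement for projective K3 surfaces -/

/-- **`AlgebraicClassesOneOneK3` granted (N1) de Rham multiplicativity and (N2) the curve slice of
Deligne's kernel theorem** — the route decl by name (the K3 hypotheses beyond
`IsSmoothProjective 2 S` are not used); CONDITIONAL on the named fact `exists_deRhamIsoFamily` and
on `hK`. [cite: VoisinHodgeI2002, Prop. 11.20] [cite: Fulton1998, §19.1 Lemma 19.1.1] -/
theorem algebraicClassesOneOneK3_of_curveKernel
    (hdR : ∀ (E : Type) [NormedAddCommGroup E] [NormedSpace ℂ E] [FiniteDimensional ℂ E],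
      exists_deRhamIsoFamily 𝓘(ℝ, E))
    (μ : OrientationFamily)
    (hK : ∀ ⦃S : SchemeOver ℂ⦄ (hS : IsSmoothProjective 2 S) (V : Set S.left), IsClosed V →
      ∀ hirr : IsIrreducible V, Order.coheight hirr.genericPoint = 1 →
        ∃ (C : SchemeOver ℂ) (hC : IsSmoothProjective 1 C) (g : C ⟶ S),
          LinearMap.ker (complexBetti.restrictCompl S V (2 * 1)).hom ≤
            LinearMap.range (complexGysin μ hC hS g (rfl : 0 + 2 * 2 = 2 * 1 + 2 * 1))) :
    Theses.NikulinTwinTransport.AlgebraicClassesOneOneK3 :=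
  fun _ hS _ hd ↦ isOfHodgeType_oneOne_of_mem_algebraicClasses_of_curveKernel hdR μ hK hS.1 hd

/-- **`AlgebraicClassesOneOneK3` from the two named facts** `Deligne1974_ker_restrictCompl_eq_iSup_range_complexGysin`
and `exists_deRhamIsoFamily` — the route decl by name, CONDITIONAL on exactly these two facts
(trust base of the item; both undischarged in the tree as of 2026-08-16).
[cite: DeligneHodgeIII1974, Cor. 8.2.8] [cite: VoisinHodgeI2002, Prop. 11.20] -/
theorem algebraicClassesOneOneK3_of_deligne
    (hD : Deligne1974_ker_restrictCompl_eq_iSup_range_complexGysin)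
    (hdR : ∀ (E : Type) [NormedAddCommGroup E] [NormedSpace ℂ E] [FiniteDimensional ℂ E],
      exists_deRhamIsoFamily 𝓘(ℝ, E)) :
    Theses.NikulinTwinTransport.AlgebraicClassesOneOneK3 :=
  fun _ hS _ hd ↦ isOfHodgeType_oneOne_of_mem_algebraicClasses_of_deligne hD hdR hS.1 hd

end Summit.HodgeConjecture.HodgeConjecture.Theorems.NikulinTwinTransport

end
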